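import Mathlib
import Literature.MathematicalPhysics.StatisticalMechanics.BarlowStackingEnergy
import Literature.MathematicalPhysics.StatisticalMechanics.LennardJonesClusters

/-!
# Route `MinMeanCycleStackingLock`, item stmt-AtomisticToContinuum-12023 `LockedBoxMinimiser` —
helper file: continuity of the Lennard-Jones layer sums in the parameters `(a, h)`

The analysis glue behind `LockedBoxMinimiser` needs that the stacking-independent energy
`e₀(a,h) = barlowBaseEnergy lennardJones a h` and the registry couplings
`J_k(a,h) = barlowCoupling lennardJones a h k` (`k ≥ 1`) of `BarlowStackingEnergy.lean` depend
continuously on the in-layer spacing `a` and the layer spacing `h`, locally uniformly, and that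
`(J_k(a,h))_{k ≥ 1}` is continuous in `ℓ¹`.  On every closed quadrant
`Set.Ici a₁ ×ˢ Set.Ici h₁ = {(a,h) | a₁ ≤ a, h₁ ≤ h}` (`a₁, h₁ > 0`):

* every term `V_LJ ‖i u + j v + δ w + k h e₃‖` of a layer sum is continuous in `(a,h)`
  (`continuousOn_lennardJones` of `LennardJonesClusters.lean`) and dominated by the
  absolute-value majorant `(1/12) r⁻¹² + (1/6) r⁻⁶` of `V_LJ` evaluated at the corner `(a₁, h₁)`
  (norms of lattice vectors increase with `a` and `h`);
* the corner majorants are summable over `(k, i, j) ∈ ℤ³` (Mathlib's lattice `p`-series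
  `ZLattice.summable_norm_sub_rpow` for the lattice `ℤu + ℤv + ℤ h e₃`, exponents `6, 12 > 3`);
* hence (`continuousOn_tsum`, Weierstrass M-test) `layerInteraction lennardJones a h δ k`
  (`k ≠ 0`), `inLayerInteraction lennardJones a`, `barlowBaseEnergy lennardJones a h` and
  `barlowCoupling lennardJones a h k` (`k ≠ 0`) are continuous on the quadrant, the couplings are
  summable with a summable majorant uniform on the quadrant, and (Tannery's theorem)
  `∑_{k ≥ 1} |J_k(a,h) − J_k(a₀,h₀)| → 0` as `(a,h) → (a₀,h₀)` inside the quadrant.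

All statements are elementary real analysis ([folklore]); they serve item 12023.  No definitions
are introduced: the majorant is written out, uniform bounds are stated as existence of a summable
majorant.
-/

noncomputable section

open Filter Topology
open Literature.MathematicalPhysics.StatisticalMechanics

namespace Summit.AtomisticToContinuum.Crystallization.Theorems.LockedBoxMinimiser

/-! ## The Lennard-Jones majorant `(1/12) r⁻¹² + (1/6) r⁻⁶` -/

/-- `|V_LJ(r)| ≤ (1/12) r⁻¹² + (1/6) r⁻⁶` for `r ≥ 0`. -/
theorem abs_lennardJones_le {r : ℝ} (hr : 0 ≤ r) :
    |lennardJones r| ≤ 1 / 12 * r⁻¹ ^ 12 + 1 / 6 * r⁻¹ ^ 6 := by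
  have h6 : 0 ≤ (r⁻¹) ^ 6 := pow_nonneg (inv_nonneg.2 hr) 6
  have h12 : 0 ≤ (r⁻¹) ^ 12 := pow_nonneg (inv_nonneg.2 hr) 12
  unfold lennardJones
  rw [abs_le]
  constructor <;> nlinarith

/-- The majorant is decreasing on `(0, ∞)`. -/
theorem ljMajorant_anti {r₁ r : ℝ} (h₁ : 0 < r₁) (h : r₁ ≤ r) :
    1 / 12 * r⁻¹ ^ 12 + 1 / 6 * r⁻¹ ^ 6 ≤ 1 / 12 * r₁⁻¹ ^ 12 + 1 / 6 * r₁⁻¹ ^ 6 := by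
  have hi : r⁻¹ ≤ r₁⁻¹ := inv_anti₀ h₁ h
  have h0 : 0 ≤ r⁻¹ := inv_nonneg.2 (h₁.le.trans h)
  gcongr

/-- `|V_LJ(r)| ≤ (1/12) r₁⁻¹² + (1/6) r₁⁻⁶` for `r ≥ r₁ > 0`. -/
theorem abs_lennardJones_le_of_le {r₁ r : ℝ} (h₁ : 0 < r₁) (h : r₁ ≤ r) :
    |lennardJones r| ≤ 1 / 12 * r₁⁻¹ ^ 12 + 1 / 6 * r₁⁻¹ ^ 6 :=
  (abs_lennardJones_le (h₁.le.trans h)).trans (ljMajorant_anti h₁ h)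

/-- The majorant is non-negative (for `r ≥ 0`). -/
theorem ljMajorant_nonneg {r : ℝ} (hr : 0 ≤ r) : 0 ≤ 1 / 12 * r⁻¹ ^ 12 + 1 / 6 * r⁻¹ ^ 6 := by
  have h0 : 0 ≤ r⁻¹ := inv_nonneg.2 hr
  positivity

/-! ## Norms of the lattice vectors `layerVec a h δ k i j` -/

/-- Norms of the lattice vectors increase with the spacings `a, h ≥ 0`. -/
theorem norm_layerVec_mono {a₁ h₁ a h : ℝ} (ha₁ : 0 ≤ a₁) (hh₁ : 0 ≤ h₁) (ha : a₁ ≤ a)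
    (hh : h₁ ≤ h) (δ k i j : ℤ) : ‖layerVec a₁ h₁ δ k i j‖ ≤ ‖layerVec a h δ k i j‖ := by
  rw [norm_layerVec, norm_layerVec]
  apply Real.sqrt_le_sqrt
  have h1 : a₁ ^ 2 ≤ a ^ 2 := pow_le_pow_left₀ ha₁ ha 2
  have h2 : h₁ ^ 2 ≤ h ^ 2 := pow_le_pow_left₀ hh₁ hh 2
  nlinarith [mul_le_mul_of_nonneg_right h1 (sq_nonneg ((i : ℝ) + j / 2 + δ / 2)),
    mul_le_mul_of_nonneg_right h1 (sq_nonneg (√3 / 2 * ((j : ℝ) + δ / 3))),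
    mul_le_mul_of_nonneg_right h2 (sq_nonneg (k : ℝ))]

/-- The vertical component bounds the norm from below: `|k h| ≤ ‖layerVec a h δ k i j‖`. -/
theorem abs_mul_le_norm_layerVec (a h : ℝ) (δ k i j : ℤ) :
    |(k : ℝ) * h| ≤ ‖layerVec a h δ k i j‖ := by
  rw [norm_layerVec]
  apply Real.abs_le_sqrt
  nlinarith [sq_nonneg (a * ((i : ℝ) + j / 2 + δ / 2)), sq_nonneg (a * √3 / 2 * ((j : ℝ) + δ / 3))]

/-- Vectors to another layer (`k ≠ 0`) have norm `≥ h`. -/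
theorem le_norm_layerVec_of_ne_zero {a h : ℝ} (hh : 0 ≤ h) {k : ℤ} (hk : k ≠ 0) (δ i j : ℤ) :
    h ≤ ‖layerVec a h δ k i j‖ := by
  refine le_trans ?_ (abs_mul_le_norm_layerVec a h δ k i j)
  rw [abs_mul, abs_of_nonneg hh]
  have : (1 : ℝ) ≤ |(k : ℝ)| := by
    rw [← Int.cast_abs]
    exact_mod_cast Int.one_le_abs hk
  nlinarith

/-- Non-zero in-layer vectors have norm `≥ a` (`|i u + j v|² = a² (i² + i j + j²) ≥ a²`). -/
theorem le_norm_layerVec_inLayer (a h : ℝ) {ij : ℤ × ℤ} (hij : ij ≠ 0) :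
    a ≤ ‖layerVec a h 0 0 ij.1 ij.2‖ := by
  rw [norm_layerVec]
  apply Real.le_sqrt_of_sq_le
  have h3 : (√3 : ℝ) ^ 2 = 3 := Real.sq_sqrt (by norm_num)
  have hform : (1 : ℝ) ≤ ((ij.1 ^ 2 + ij.1 * ij.2 + ij.2 ^ 2 : ℤ) : ℝ) := by
    exact_mod_cast one_le_sq_add_mul_add_sq (p := ij.1) (q := ij.2)
      (by simpa [Prod.ext_iff] using hij)
  push_cast at hform ⊢
  have key : (a * ((ij.1 : ℝ) + ij.2 / 2 + (0 : ℤ) / 2)) ^ 2 +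
      (a * √3 / 2 * ((ij.2 : ℝ) + (0 : ℤ) / 3)) ^ 2 + ((0 : ℤ) * h) ^ 2 =
      a ^ 2 * ((ij.1 : ℝ) ^ 2 + ij.1 * ij.2 + ij.2 ^ 2) := by
    push_cast
    linear_combination (a ^ 2 * (ij.2 : ℝ) ^ 2 / 4) * h3
  push_cast at key
  rw [key]
  nlinarith [mul_le_mul_of_nonneg_left hform (sq_nonneg a)]

/-- The norm `‖layerVec a h δ k i j‖` is a continuous function of `(a, h)`. -/
theorem continuous_norm_layerVec (δ k i j : ℤ) :
    Continuous fun p : ℝ × ℝ => ‖layerVec p.1 p.2 δ k i j‖ := by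
  simp only [norm_layerVec]
  fun_prop

/-! ## Summability of the majorants over `ℤ³` -/

/-- The lattice `p`-series: `∑_{(k,i,j) ∈ ℤ³} ‖i u + j v + δ w + k h e₃‖ ^ r < ∞` for `r < -3`
(`a, h ≠ 0`), from `ZLattice.summable_norm_sub_rpow` for the lattice `ℤu + ℤv + ℤ h e₃` and the
shift `-δ w`. -/
theorem summable_norm_layerVec_rpow {a h : ℝ} (ha : a ≠ 0) (hh : h ≠ 0) (δ : ℤ) {r : ℝ}
    (hr : r < -3) : Summable fun x : ℤ × ℤ × ℤ => ‖layerVec a h δ x.1 x.2.1 x.2.2‖ ^ r := by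
  set b := barlowPeriodBasis (a := a) (h := h) (fun _ : ℤ => (0 : ℤ)) ha hh
    (one_ne_zero : (1 : ℕ) ≠ 0) with hb
  set L : Submodule ℤ (EuclideanSpace ℝ (Fin 3)) := Submodule.span ℤ (Set.range b) with hL
  -- the lattice points `i u + j v + k h e₃`
  set z : ℤ × ℤ × ℤ → EuclideanSpace ℝ (Fin 3) := fun x =>
    (x.2.1 : ℝ) • triangularVec₁ a + (x.2.2 : ℝ) • triangularVec₂ a +
      (x.1 : ℝ) • (((haggWindow (fun _ : ℤ => (0 : ℤ)) 0 1 : ℤ) : ℝ) • barlowOffset a +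
        ((1 : ℕ) : ℝ) • layerNormal h) with hz
  have hmem : ∀ x, z x ∈ L := fun x =>
    sum_smul_mem_barlowPeriodLattice (fun _ : ℤ => (0 : ℤ)) ha hh one_ne_zero x.2.1 x.2.2 x.1
  have hW : ((haggWindow (fun _ : ℤ => (0 : ℤ)) 0 1 : ℤ) : ℝ) = 0 := by simp [haggWindow]
  have hzv : ∀ x, layerVec a h δ x.1 x.2.1 x.2.2 = z x - (-((δ : ℝ) • barlowOffset a)) := by
    intro x
    simp only [hz, layerVec, hW, zero_smul, zero_add, Nat.cast_one, one_smul, sub_neg_eq_add]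
    abel
  have hinj : Function.Injective fun x : ℤ × ℤ × ℤ => (⟨z x, hmem x⟩ : L) := by
    intro x y hxy
    have hv : layerVec a h δ x.1 x.2.1 x.2.2 = layerVec a h δ y.1 y.2.1 y.2.2 := by
      rw [hzv, hzv, show z x = z y from congrArg Subtype.val hxy]
    have e2 := congrArg (fun v : EuclideanSpace ℝ (Fin 3) => v 2) hv
    have e1 := congrArg (fun v : EuclideanSpace ℝ (Fin 3) => v 1) hv
    have e0 := congrArg (fun v : EuclideanSpace ℝ (Fin 3) => v 0) hv
    simp only [layerVec_apply_two, layerVec_apply_one, layerVec_apply_zero] at e0 e1 e2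
    have h3 : (√3 : ℝ) ≠ 0 := by positivity
    have hk : (x.1 : ℝ) = y.1 := by
      have := mul_right_cancel₀ hh e2
      exact_mod_cast this
    have hj : (x.2.2 : ℝ) = y.2.2 := by
      have h' : a * √3 / 2 ≠ 0 := by positivity
      have := mul_left_cancel₀ h' e1
      linarith
    have hi : (x.2.1 : ℝ) = y.2.1 := by
      have := mul_left_cancel₀ ha e0
      linarith
    have hk' : x.1 = y.1 := by exact_mod_cast hk
    have hj' : x.2.2 = y.2.2 := by exact_mod_cast hj
    have hi' : x.2.1 = y.2.1 := by exact_mod_cast hi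
    exact Prod.ext hk' (Prod.ext hi' hj')
  have hrank : Module.finrank ℤ L = 3 := by
    rw [ZLattice.rank ℝ L, finrank_euclideanSpace_fin]
  have hsum := ZLattice.summable_norm_sub_rpow L r (by rw [hrank]; exact_mod_cast hr)
    (-((δ : ℝ) • barlowOffset a))
  have := hsum.comp_injective hinj
  refine this.congr fun x => ?_
  simp only [Function.comp_apply, hzv]

/-- The majorants `(1/12)‖·‖⁻¹² + (1/6)‖·‖⁻⁶` of the lattice vectors are summable over `ℤ³`
(`a, h > 0`). -/
theorem summable_ljMajorant_norm_layerVec {a h : ℝ} (ha : 0 < a) (hh : 0 < h) (δ : ℤ) :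
    Summable fun x : ℤ × ℤ × ℤ => 1 / 12 * ‖layerVec a h δ x.1 x.2.1 x.2.2‖⁻¹ ^ 12 +
      1 / 6 * ‖layerVec a h δ x.1 x.2.1 x.2.2‖⁻¹ ^ 6 := by
  have h12 := summable_norm_layerVec_rpow ha.ne' hh.ne' δ (show (-12 : ℝ) < -3 by norm_num)
  have h6 := summable_norm_layerVec_rpow ha.ne' hh.ne' δ (show (-6 : ℝ) < -3 by norm_num)
  refine ((h12.mul_left (1 / 12)).add (h6.mul_left (1 / 6))).congr fun x => ?_
  have h0 : (0 : ℝ) ≤ ‖layerVec a h δ x.1 x.2.1 x.2.2‖ := norm_nonneg _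
  rw [Real.rpow_neg h0, Real.rpow_neg h0, inv_pow, inv_pow]
  norm_cast

/-! ## Continuity and bounds of the layer sums -/

/-- **`layerInteraction lennardJones a h δ k` is continuous in `(a, h)`** on every quadrant
`a ≥ a₁ > 0`, `h ≥ h₁ > 0`, for `k ≠ 0` (Weierstrass M-test with the corner majorants). -/
theorem continuousOn_layerInteraction {a₁ h₁ : ℝ} (ha₁ : 0 < a₁) (hh₁ : 0 < h₁) (δ : ℤ) {k : ℤ}
    (hk : k ≠ 0) : ContinuousOn (fun p : ℝ × ℝ => layerInteraction lennardJones p.1 p.2 δ k)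
      (Set.Ici a₁ ×ˢ Set.Ici h₁) := by
  unfold layerInteraction
  refine continuousOn_tsum (u := fun ij : ℤ × ℤ => 1 / 12 * ‖layerVec a₁ h₁ δ k ij.1 ij.2‖⁻¹ ^ 12 +
      1 / 6 * ‖layerVec a₁ h₁ δ k ij.1 ij.2‖⁻¹ ^ 6) (fun ij => ?_)
    ((summable_ljMajorant_norm_layerVec ha₁ hh₁ δ).prod_factor k) ?_
  · refine continuousOn_lennardJones.comp (continuous_norm_layerVec δ k ij.1 ij.2).continuousOn ?_
    intro p hp
    have h1 := le_norm_layerVec_of_ne_zero (a := p.1) (hh₁.le.trans hp.2) hk δ ij.1 ij.2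
    simp only [Set.mem_compl_iff, Set.mem_singleton_iff]
    exact (hh₁.trans_le (le_trans hp.2 h1)).ne'
  · intro ij p hp
    rw [Real.norm_eq_abs]
    have hr₁ : 0 < ‖layerVec a₁ h₁ δ k ij.1 ij.2‖ :=
      hh₁.trans_le (le_norm_layerVec_of_ne_zero hh₁.le hk δ _ _)
    exact abs_lennardJones_le_of_le hr₁ (norm_layerVec_mono ha₁.le hh₁.le hp.1 hp.2 δ k _ _)

/-- **Uniform summable majorant of the layer sums**: there is a summable `u : ℤ → ℝ` with
`|layerInteraction lennardJones a h δ k| ≤ u k` for all `k ≠ 0` and all `(a, h)` in the quadrant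
(namely `u k = ∑_{(i,j)}` corner majorants). -/
theorem exists_bound_layerInteraction {a₁ h₁ : ℝ} (ha₁ : 0 < a₁) (hh₁ : 0 < h₁) (δ : ℤ) :
    ∃ u : ℤ → ℝ, Summable u ∧ ∀ k : ℤ, k ≠ 0 → ∀ p ∈ Set.Ici a₁ ×ˢ Set.Ici h₁,
      |layerInteraction lennardJones p.1 p.2 δ k| ≤ u k := by
  have hS := summable_ljMajorant_norm_layerVec ha₁ hh₁ δ
  refine ⟨fun k => ∑' ij : ℤ × ℤ, (1 / 12 * ‖layerVec a₁ h₁ δ k ij.1 ij.2‖⁻¹ ^ 12 +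
      1 / 6 * ‖layerVec a₁ h₁ δ k ij.1 ij.2‖⁻¹ ^ 6), hS.prod, fun k hk p hp => ?_⟩
  rw [← Real.norm_eq_abs]
  unfold layerInteraction
  refine tsum_of_norm_bounded (hS.prod_factor k).hasSum fun ij => ?_
  rw [Real.norm_eq_abs]
  have hr₁ : 0 < ‖layerVec a₁ h₁ δ k ij.1 ij.2‖ :=
    hh₁.trans_le (le_norm_layerVec_of_ne_zero hh₁.le hk δ _ _)
  exact abs_lennardJones_le_of_le hr₁ (norm_layerVec_mono ha₁.le hh₁.le hp.1 hp.2 δ k _ _)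

/-- The tail `∑_{k ≥ 1} Φ_N(k)` of `barlowBaseEnergy` is continuous in `(a, h)` on the quadrant. -/
theorem continuousOn_tsum_layerInteraction {a₁ h₁ : ℝ} (ha₁ : 0 < a₁) (hh₁ : 0 < h₁) :
    ContinuousOn (fun p : ℝ × ℝ =>
      ∑' k : ℕ, layerInteraction lennardJones p.1 p.2 1 ((k + 1 : ℕ) : ℤ))
      (Set.Ici a₁ ×ˢ Set.Ici h₁) := by
  obtain ⟨u, hu, hb⟩ := exists_bound_layerInteraction ha₁ hh₁ 1
  have hinj : Function.Injective fun k : ℕ => ((k + 1 : ℕ) : ℤ) := by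
    intro m n hmn
    have h' : ((m + 1 : ℕ) : ℤ) = ((n + 1 : ℕ) : ℤ) := hmn
    omega
  have hs : Summable fun k : ℕ => u ((k + 1 : ℕ) : ℤ) := (hu.comp_injective hinj).congr fun _ => rfl
  refine continuousOn_tsum (fun k => continuousOn_layerInteraction ha₁ hh₁ 1 ?_) hs ?_
  · exact_mod_cast Nat.succ_ne_zero k
  · intro k p hp
    rw [Real.norm_eq_abs]
    exact hb _ (by exact_mod_cast Nat.succ_ne_zero k) p hp

/-- The punctured in-layer sum `inLayerInteraction lennardJones a` is continuous in `a`
(stated on the quadrant in `(a, h)`). -/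
theorem continuousOn_inLayerInteraction {a₁ h₁ : ℝ} (ha₁ : 0 < a₁) (hh₁ : 0 < h₁) :
    ContinuousOn (fun p : ℝ × ℝ => inLayerInteraction lennardJones p.1)
      (Set.Ici a₁ ×ˢ Set.Ici h₁) := by
  unfold inLayerInteraction
  refine continuousOn_tsum (u := fun ij : ℤ × ℤ => 1 / 12 * ‖layerVec a₁ h₁ 0 0 ij.1 ij.2‖⁻¹ ^ 12 +
      1 / 6 * ‖layerVec a₁ h₁ 0 0 ij.1 ij.2‖⁻¹ ^ 6)
    ?_ ((summable_ljMajorant_norm_layerVec ha₁ hh₁ 0).prod_factor 0) ?_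
  · intro ij
    by_cases hij : ij = 0
    · simp only [hij, if_true]
      exact continuousOn_const
    · simp only [hij, if_false]
      have e : (fun p : ℝ × ℝ => lennardJones
          ‖(ij.1 : ℝ) • triangularVec₁ p.1 + (ij.2 : ℝ) • triangularVec₂ p.1‖) =
          fun p => lennardJones ‖layerVec p.1 p.2 0 0 ij.1 ij.2‖ := by
        funext p
        rw [layerVec_zero_zero]
      rw [e]
      refine continuousOn_lennardJones.comp (continuous_norm_layerVec 0 0 ij.1 ij.2).continuousOn
        ?_
      intro p hp
      have h1 := le_norm_layerVec_inLayer p.1 p.2 hij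
      have hp1 : a₁ ≤ p.1 := hp.1
      simp only [Set.mem_compl_iff, Set.mem_singleton_iff]
      exact (ha₁.trans_le (hp1.trans h1)).ne'
  · intro ij p hp
    by_cases hij : ij = 0
    · simp only [hij, if_true, norm_zero]
      exact ljMajorant_nonneg (norm_nonneg _)
    · simp only [hij, if_false, Real.norm_eq_abs]
      rw [← layerVec_zero_zero p.1 p.2]
      have hr₁ : 0 < ‖layerVec a₁ h₁ 0 0 ij.1 ij.2‖ :=
        ha₁.trans_le (le_norm_layerVec_inLayer a₁ h₁ hij)
      exact abs_lennardJones_le_of_le hr₁ (norm_layerVec_mono ha₁.le hh₁.le hp.1 hp.2 0 0 _ _)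

/-- **`barlowBaseEnergy lennardJones a h` is continuous in `(a, h)`** on the quadrant. -/
theorem continuousOn_barlowBaseEnergy {a₁ h₁ : ℝ} (ha₁ : 0 < a₁) (hh₁ : 0 < h₁) :
    ContinuousOn (fun p : ℝ × ℝ => barlowBaseEnergy lennardJones p.1 p.2)
      (Set.Ici a₁ ×ˢ Set.Ici h₁) := by
  unfold barlowBaseEnergy
  exact (continuousOn_const.mul (continuousOn_inLayerInteraction ha₁ hh₁)).add
    (continuousOn_tsum_layerInteraction ha₁ hh₁)

/-- **`barlowCoupling lennardJones a h k` is continuous in `(a, h)`** on the quadrant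
(`k ≠ 0`). -/
theorem continuousOn_barlowCoupling {a₁ h₁ : ℝ} (ha₁ : 0 < a₁) (hh₁ : 0 < h₁) {k : ℕ}
    (hk : k ≠ 0) : ContinuousOn (fun p : ℝ × ℝ => barlowCoupling lennardJones p.1 p.2 k)
      (Set.Ici a₁ ×ˢ Set.Ici h₁) := by
  have hk' : (k : ℤ) ≠ 0 := by exact_mod_cast hk
  unfold barlowCoupling
  exact (continuousOn_layerInteraction ha₁ hh₁ 0 hk').sub
    (continuousOn_layerInteraction ha₁ hh₁ 1 hk')

/-- **Uniform summable majorant of the couplings**: there is a summable `u : ℕ → ℝ` with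
`|J_{k+1}(a, h)| ≤ u k` for all `k` and all `(a, h)` in the quadrant. -/
theorem exists_bound_barlowCoupling {a₁ h₁ : ℝ} (ha₁ : 0 < a₁) (hh₁ : 0 < h₁) :
    ∃ u : ℕ → ℝ, Summable u ∧ ∀ k : ℕ, ∀ p ∈ Set.Ici a₁ ×ˢ Set.Ici h₁,
      |barlowCoupling lennardJones p.1 p.2 (k + 1)| ≤ u k := by
  obtain ⟨u₀, hu₀, hb₀⟩ := exists_bound_layerInteraction ha₁ hh₁ 0
  obtain ⟨u₁, hu₁, hb₁⟩ := exists_bound_layerInteraction ha₁ hh₁ 1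
  have hinj : Function.Injective fun k : ℕ => ((k + 1 : ℕ) : ℤ) := by
    intro m n hmn
    have h' : ((m + 1 : ℕ) : ℤ) = ((n + 1 : ℕ) : ℤ) := hmn
    omega
  have h0 : Summable fun k : ℕ => u₀ ((k + 1 : ℕ) : ℤ) :=
    (hu₀.comp_injective hinj).congr fun _ => rfl
  have h1 : Summable fun k : ℕ => u₁ ((k + 1 : ℕ) : ℤ) :=
    (hu₁.comp_injective hinj).congr fun _ => rfl
  refine ⟨fun k => u₀ ((k + 1 : ℕ) : ℤ) + u₁ ((k + 1 : ℕ) : ℤ), h0.add h1, fun k p hp => ?_⟩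
  have hk : (((k + 1 : ℕ)) : ℤ) ≠ 0 := by exact_mod_cast Nat.succ_ne_zero k
  unfold barlowCoupling
  exact (abs_sub _ _).trans (add_le_add (hb₀ _ hk p hp) (hb₁ _ hk p hp))

/-- **The Lennard-Jones registry couplings are summable** (`a, h > 0`). -/
theorem summable_barlowCoupling {a h : ℝ} (ha : 0 < a) (hh : 0 < h) :
    Summable (barlowCoupling lennardJones a h) := by
  obtain ⟨u, hu, hb⟩ := exists_bound_barlowCoupling ha hh
  rw [← summable_nat_add_iff 1]
  refine Summable.of_norm_bounded hu fun k => ?_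
  rw [Real.norm_eq_abs]
  exact hb k (a, h) ⟨Set.self_mem_Ici, Set.self_mem_Ici⟩

/-- **`ℓ¹`-continuity of the couplings** (Tannery's theorem): on the quadrant,
`∑_{k ≥ 1} |J_k(a,h) − J_k(a₀,h₀)| → 0` as `(a,h) → (a₀,h₀)`. -/
theorem tendsto_tsum_abs_barlowCoupling_sub {a₁ h₁ : ℝ} (ha₁ : 0 < a₁) (hh₁ : 0 < h₁)
    {p₀ : ℝ × ℝ} (hp₀ : p₀ ∈ Set.Ici a₁ ×ˢ Set.Ici h₁) :
    Tendsto (fun p : ℝ × ℝ => ∑' k : ℕ, |barlowCoupling lennardJones p.1 p.2 (k + 1) -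
      barlowCoupling lennardJones p₀.1 p₀.2 (k + 1)|) (𝓝[Set.Ici a₁ ×ˢ Set.Ici h₁] p₀) (𝓝 0) := by
  obtain ⟨u, hu, hb⟩ := exists_bound_barlowCoupling ha₁ hh₁
  have h := tendsto_tsum_of_dominated_convergence (𝓕 := 𝓝[Set.Ici a₁ ×ˢ Set.Ici h₁] p₀)
    (f := fun (p : ℝ × ℝ) (k : ℕ) => |barlowCoupling lennardJones p.1 p.2 (k + 1) -
      barlowCoupling lennardJones p₀.1 p₀.2 (k + 1)|)
    (g := fun _ => (0 : ℝ)) (bound := fun k => 2 * u k) (hu.mul_left 2) ?_ ?_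
  · simpa using h
  · intro k
    have hc := (continuousOn_barlowCoupling ha₁ hh₁ (Nat.succ_ne_zero k)) p₀ hp₀
    have h2 : Tendsto (fun p : ℝ × ℝ => barlowCoupling lennardJones p.1 p.2 (k + 1) -
        barlowCoupling lennardJones p₀.1 p₀.2 (k + 1)) (𝓝[Set.Ici a₁ ×ˢ Set.Ici h₁] p₀)
        (𝓝 0) := by
      have := hc.tendsto.sub_const (barlowCoupling lennardJones p₀.1 p₀.2 (k + 1))
      simpa using this
    simpa using h2.abs
  · filter_upwards [self_mem_nhdsWithin] with p hp
    intro k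
    rw [Real.norm_eq_abs, abs_abs]
    calc |barlowCoupling lennardJones p.1 p.2 (k + 1) -
          barlowCoupling lennardJones p₀.1 p₀.2 (k + 1)|
        ≤ |barlowCoupling lennardJones p.1 p.2 (k + 1)| +
          |barlowCoupling lennardJones p₀.1 p₀.2 (k + 1)| := abs_sub _ _
      _ ≤ u k + u k := add_le_add (hb k p hp) (hb k p₀ hp₀)
      _ = 2 * u k := by ring

end Summit.AtomisticToContinuum.Crystallization.Theorems.LockedBoxMinimiser

end
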